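import Summits.QuantumFields.QCD.Theorems.PauliWegnerSeaFMClosureUnquenchedClosureC1Aux4

/-!
# Crux `FMClosureUnquenched` (stmt-QuantumFields-11512), line `von-mises-circles`, stub `stub_closure`:
helper 5 — one-step subharmonicity across the thick collar

At a fixed volume, coupling, mass vector, probe flavour and exponent `t`, with `W = ebox(x, ℓ)`,
`Λ = ebox(x, 3ℓ+2)` (`1 ≤ ℓ`, `3ℓ + 4 ≤ S`) and `E(x,y) = pqE[‖D_f⁻¹(x,y)‖₁^t]`:

* `c1_far_le` — the FAR factor ((Rout) a.e. + subadditivity + (Tdec) on `Λᶜ`): for `v', y ∉ Λ`,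
  `pqE[‖G_{Λᶜ}(v',y)‖^t] ≤ E(v',y) + c_T^t Ξ_{3ℓ+2} |boxOut(3ℓ+2)| Σ_{w ∈ boxIn(3ℓ+2)} E(w,y)`;
* `c1_twoCut_le` — the TWO-CUT bound ((R2) a.e. [(Tinv) for `W`, `Λᶜ`] + subadditivity + (T1) +
  `FarStability`): if the exit moment satisfies `A(u)^θ + A(u) ≤ α` on `boxIn ℓ`, then for `y ∉ Λ`
  `E(x,y) ≤ (c_T²)^t |boxIn ℓ| |boxOut ℓ| |boxIn(3ℓ+2)| Ξ_ℓ R_ℓ α · Σ_{v' ∈ boxOut(3ℓ+2)} pqE[‖G_{Λᶜ}(v',y)‖^t]`;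
* `c1_subharmonic_le` — the two combined: `E(x,y) ≤ Γ · Σ_{z ∈ boxIn(3ℓ+2) ∪ boxOut(3ℓ+2)} E(z,y)`, the
  `hstep` of the iteration lemma `SubharmonicIteration.le_mul_pow_div_of_sum_step`.

References: Aizenman–Schenker–Friedrich–Hundertmark, CMP 224 (2001) 219, §2 (2.14)–(2.17), Lemma 6
[AizenmanEtAl2001].
-/

noncomputable section

open scoped BigOperators
open MeasureTheory Filter
open Literature.MathematicalPhysics.QuantumFieldTheory Literature.MathematicalPhysics.QuantumLattice
  Literature.Probability.LatticeModels Literature.Probability.Moments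
open Summit.QuantumFields.QCD.Theorems.VonMisesCircles

namespace Summit.QuantumFields.QCD.Theorems.VonMisesCirclesC1


/-- **Registered helper of crux stmt-QuantumFields-11512** (line `von-mises-circles`, stub `stub_closure`): a point of
`boxIn r ∪ boxOut r` is `x + proj w` with `w ∈ box S`, `‖w‖_∞ ≥ r` (`r + 2 ≤ S`). [folklore] -/
theorem c1_exists_offset_of_mem_boxIn_union_boxOut : ∀ {S : ℕ} {x z : TorusSite 4 (2 * S + 1)} {r : ℕ}, r + 2 ≤ S → z ∈ boxIn S x r ∪ boxOut S x r → ∃ w : Literature.Probability.LatticeModels.Site 4, w ∈ box 4 S ∧ r ≤ Literature.Probability.LatticeModels.Site.supNorm w ∧ z = x + Torus.proj (2 * S + 1) w := by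
  intro S x z r hrS hz
  rcases Finset.mem_union.1 hz with h | h
  · obtain ⟨w, hw, ⟨i, hi⟩, rfl⟩ := c1_mem_boxIn.1 h
    refine ⟨w, mem_box.2 fun j => by have := hw j; omega, ?_, rfl⟩
    have h1 := Site.natAbs_le_supNorm w i
    omega
  · obtain ⟨w, hw, ⟨i, hi⟩, rfl⟩ := c1_mem_boxOut.1 h
    refine ⟨w, mem_box.2 fun j => by have := hw j; omega, ?_, rfl⟩
    have h1 := Site.natAbs_le_supNorm w i
    omega

section Steps

variable {Nf S : ℕ} {β t s₀ C p Cf pf θ cT : ℝ} {mq : Fin Nf → ℝ} {f : Fin Nf}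

variable (ht0 : 0 < t) (ht1 : t ≤ 1) (hts : t ≤ s₀) (hcT : 0 < cT) (hC : 0 < C) (hCf : 0 < Cf)
  (hT0 : ∀ (s₁ s₂ s₃ : ℝ), 0 ≤ s₁ → s₁ ≤ s₀ → 0 ≤ s₂ → s₂ ≤ s₀ → 0 ≤ s₃ → s₃ ≤ s₀ →
      ∀ (A₁ A₂ A₃ : Finset (TorusSite 4 (2 * S + 1))),
        AdmissibleSide S A₁ → AdmissibleSide S A₂ → AdmissibleSide S A₃ →
      ∀ (a₁ b₁ a₂ b₂ a₃ b₃ : TorusSite 4 (2 * S + 1)),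
      Integrable (fun U : GaugeConfig 4 (2 * S + 1) (Matrix.specialUnitaryGroup (Fin 3) ℂ) =>
        ‖(diracMatrix U mq).det‖ *
          (blockNorm (gside A₁ (wilsonD U (mq f))) a₁ b₁ ^ s₁ *
            blockNorm (gside A₂ (wilsonD U (mq f))) a₂ b₂ ^ s₂ *
            blockNorm (gside A₃ (wilsonD U (mq f))) a₃ b₃ ^ s₃))
        (wilsonMeasure (fundamentalRep (Fin 3)) β))
  (hTinv : ∀ (A : Finset (TorusSite 4 (2 * S + 1))), AdmissibleSide S A →
      ∀ᵐ U ∂(wilsonMeasure (d := 4) (L := 2 * S + 1) (fundamentalRep (Fin 3)) β),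
        (sideMatrix A (wilsonD U (mq f))).det ≠ 0)
  (hTdec : ∀ (x : TorusSite 4 (2 * S + 1)) (r : ℕ), 1 ≤ r → r + 1 ≤ S →
      ∀ (A : Finset (TorusSite 4 (2 * S + 1))),
        (A = ebox S x r ∨ A = (ebox S x r)ᶜ ∨ A = (ball S x r)ᶜ) →
      ∀ a b c d : TorusSite 4 (2 * S + 1), a ∈ A → b ∈ A →
        pqE Nf S β mq (fun U =>
            blockNorm (gside A (wilsonD U (mq f))) a b ^ t * blockNorm (wilsonD U (mq f))⁻¹ c d ^ t) ≤
          C * (1 + |β|) ^ p * (1 + (r : ℝ)) ^ p *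
            pqE Nf S β mq (fun U => blockNorm (wilsonD U (mq f))⁻¹ c d ^ t))
  (hT1 : ∀ (x : TorusSite 4 (2 * S + 1)) (ℓ : ℕ), 1 ≤ ℓ → 3 * ℓ + 4 ≤ S →
      ∀ u u' v v' y : TorusSite 4 (2 * S + 1),
        u' ∈ ebox S x (3 * ℓ + 2) → u' ∉ ebox S x ℓ → v ∈ ebox S x (3 * ℓ + 2) → v ∉ ebox S x ℓ →
        v' ∉ ebox S x (3 * ℓ + 2) → y ∉ ebox S x (3 * ℓ + 2) →
          pqE Nf S β mq (fun U =>
              blockNorm (gside (ebox S x ℓ) (wilsonD U (mq f))) x u ^ t *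
                blockNorm (wilsonD U (mq f))⁻¹ u' v ^ t *
                blockNorm (gside (ebox S x (3 * ℓ + 2))ᶜ (wilsonD U (mq f))) v' y ^ t) ≤
            C * (1 + |β|) ^ p * (1 + (ℓ : ℝ)) ^ p *
              pqE Nf S β mq (fun U =>
                blockNorm (gside (ebox S x ℓ) (wilsonD U (mq f))) x u ^ t *
                  blockNorm (gside (ebox S x (3 * ℓ + 2))ᶜ (wilsonD U (mq f))) v' y ^ t))
  (hFar : ∀ (x : TorusSite 4 (2 * S + 1)) (ℓ : ℕ), 1 ≤ ℓ → 3 * ℓ + 4 ≤ S →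
      ∀ u v' y : TorusSite 4 (2 * S + 1),
        u ∈ ebox S x ℓ → v' ∉ ebox S x (3 * ℓ + 2) → y ∉ ebox S x (3 * ℓ + 2) →
        pqE Nf S β mq (fun U =>
            blockNorm (gside (ebox S x ℓ) (wilsonD U (mq f))) x u ^ t *
              blockNorm (gside (ebox S x (3 * ℓ + 2))ᶜ (wilsonD U (mq f))) v' y ^ t) ≤
          Cf * (1 + |β|) ^ pf * (1 + (ℓ : ℝ)) ^ pf *
            (pqE Nf S β mq (fun U => blockNorm (gside (ebox S x ℓ) (wilsonD U (mq f))) x u ^ t) ^ θ +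
              pqE Nf S β mq (fun U => blockNorm (gside (ebox S x ℓ) (wilsonD U (mq f))) x u ^ t)) *
            pqE Nf S β mq (fun U =>
              blockNorm (gside (ebox S x (3 * ℓ + 2))ᶜ (wilsonD U (mq f))) v' y ^ t))
  (hR : ∀ (U : GaugeConfig 4 (2 * S + 1) (Matrix.specialUnitaryGroup (Fin 3) ℂ))
      (x : TorusSite 4 (2 * S + 1)),
      (∀ r : ℕ, 1 ≤ r → r + 1 ≤ S → ∀ z : TorusSite 4 (2 * S + 1), z ∉ ball S x r →
        (sideMatrix (ball S x r)ᶜ (wilsonD U (mq f))).det ≠ 0 →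
          blockNorm (wilsonD U (mq f))⁻¹ x z ≤
            cT * ∑ p ∈ sphere S x r, ∑ p' ∈ sphere S x (r + 1),
              blockNorm (wilsonD U (mq f))⁻¹ x p * blockNorm (gside (ball S x r)ᶜ (wilsonD U (mq f))) p' z) ∧
      ∀ ℓ : ℕ, 1 ≤ ℓ → ℓ + 2 ≤ S →
        (∀ u : TorusSite 4 (2 * S + 1), u ∈ ebox S x ℓ → (wilsonD U (mq f)).det ≠ 0 →
          blockNorm (gside (ebox S x ℓ) (wilsonD U (mq f))) x u ≤
            blockNorm (wilsonD U (mq f))⁻¹ x u +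
              cT * ∑ w' ∈ boxOut S x ℓ, ∑ w ∈ boxIn S x ℓ,
                blockNorm (wilsonD U (mq f))⁻¹ x w' * blockNorm (gside (ebox S x ℓ) (wilsonD U (mq f))) w u) ∧
        (3 * ℓ + 4 ≤ S →
          (∀ v' y : TorusSite 4 (2 * S + 1), v' ∉ ebox S x (3 * ℓ + 2) → y ∉ ebox S x (3 * ℓ + 2) →
            (wilsonD U (mq f)).det ≠ 0 →
              blockNorm (gside (ebox S x (3 * ℓ + 2))ᶜ (wilsonD U (mq f))) v' y ≤
                blockNorm (wilsonD U (mq f))⁻¹ v' y +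
                  cT * ∑ w' ∈ boxOut S x (3 * ℓ + 2), ∑ w ∈ boxIn S x (3 * ℓ + 2),
                    blockNorm (gside (ebox S x (3 * ℓ + 2))ᶜ (wilsonD U (mq f))) v' w' *
                      blockNorm (wilsonD U (mq f))⁻¹ w y) ∧
          (∀ y : TorusSite 4 (2 * S + 1), y ∉ ebox S x (3 * ℓ + 2) →
            (sideMatrix (ebox S x ℓ) (wilsonD U (mq f))).det ≠ 0 →
            (sideMatrix (ebox S x (3 * ℓ + 2))ᶜ (wilsonD U (mq f))).det ≠ 0 →
              blockNorm (wilsonD U (mq f))⁻¹ x y ≤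
                cT ^ 2 * ∑ u ∈ boxIn S x ℓ, ∑ u' ∈ boxOut S x ℓ,
                  ∑ v ∈ boxIn S x (3 * ℓ + 2), ∑ v' ∈ boxOut S x (3 * ℓ + 2),
                    blockNorm (gside (ebox S x ℓ) (wilsonD U (mq f))) x u * blockNorm (wilsonD U (mq f))⁻¹ u' v *
                      blockNorm (gside (ebox S x (3 * ℓ + 2))ᶜ (wilsonD U (mq f))) v' y)))

include ht0 ht1 hts hcT hT0 hTinv hTdec hR

/-- **The far factor** ((Rout) a.e. + subadditivity + (Tdec) on `Λᶜ`): for `v', y ∉ Λ = ebox(x, 3ℓ+2)`,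
`pqE[‖G_{Λᶜ}(v',y)‖^t] ≤ E(v',y) + c_T^t Ξ_{3ℓ+2} |boxOut(3ℓ+2)| Σ_{w ∈ boxIn(3ℓ+2)} E(w,y)`.
[cite: AizenmanEtAl2001, §2 (2.16)] -/
theorem c1_far_le (x : TorusSite 4 (2 * S + 1)) {ℓ : ℕ} (hℓ1 : 1 ≤ ℓ) (hℓS : 3 * ℓ + 4 ≤ S)
    (v' y : TorusSite 4 (2 * S + 1)) (hv' : v' ∉ ebox S x (3 * ℓ + 2)) (hy : y ∉ ebox S x (3 * ℓ + 2)) :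
    pqE Nf S β mq (fun U => blockNorm (gside (ebox S x (3 * ℓ + 2))ᶜ (wilsonD U (mq f))) v' y ^ t) ≤
      pqE Nf S β mq (fun U => blockNorm (wilsonD U (mq f))⁻¹ v' y ^ t) +
        cT ^ t * (C * (1 + |β|) ^ p * (1 + ((3 * ℓ + 2 : ℕ) : ℝ)) ^ p) * (boxOut S x (3 * ℓ + 2)).card *
          ∑ w ∈ boxIn S x (3 * ℓ + 2), pqE Nf S β mq (fun U => blockNorm (wilsonD U (mq f))⁻¹ w y ^ t) := by
  have hℓ2 : ℓ + 2 ≤ S := by omega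
  have hr1 : 1 ≤ 3 * ℓ + 2 := by omega
  have hrS : 3 * ℓ + 2 + 1 ≤ S := by omega
  have hrS2 : 3 * ℓ + 2 + 2 ≤ S := by omega
  have hadm : AdmissibleSide S (ebox S x (3 * ℓ + 2))ᶜ := Or.inr ⟨x, 3 * ℓ + 2, hr1, hrS, Or.inr (Or.inl rfl)⟩
  -- the a.e. pointwise bound
  have hae : ∀ᵐ U ∂(wilsonMeasure (d := 4) (L := 2 * S + 1) (fundamentalRep (Fin 3)) β),
      blockNorm (gside (ebox S x (3 * ℓ + 2))ᶜ (wilsonD U (mq f))) v' y ^ t ≤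
        blockNorm (wilsonD U (mq f))⁻¹ v' y ^ t +
          cT ^ t * ∑ w' ∈ boxOut S x (3 * ℓ + 2), ∑ w ∈ boxIn S x (3 * ℓ + 2),
            blockNorm (gside (ebox S x (3 * ℓ + 2))ᶜ (wilsonD U (mq f))) v' w' ^ t *
              blockNorm (wilsonD U (mq f))⁻¹ w y ^ t := by
    filter_upwards [c1_ae_det_wilsonD_ne_zero hTinv] with U hU
    have h1 := (((hR U x).2 ℓ hℓ1 hℓ2).2 hℓS).1 v' y hv' hy hU
    have hS0 : 0 ≤ cT * ∑ w' ∈ boxOut S x (3 * ℓ + 2), ∑ w ∈ boxIn S x (3 * ℓ + 2),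
        blockNorm (gside (ebox S x (3 * ℓ + 2))ᶜ (wilsonD U (mq f))) v' w' * blockNorm (wilsonD U (mq f))⁻¹ w y :=
      mul_nonneg hcT.le (Finset.sum_nonneg fun _ _ => Finset.sum_nonneg fun _ _ =>
        mul_nonneg (blockNorm_nonneg _ _ _) (blockNorm_nonneg _ _ _))
    refine (Real.rpow_le_rpow (blockNorm_nonneg _ _ _) h1 ht0.le).trans
      ((Real.rpow_add_le_add_rpow (blockNorm_nonneg _ _ _) hS0 ht0.le ht1).trans (add_le_add le_rfl ?_))
    refine (c1_rpow_const_mul_sum_le _ hcT.le _ (fun w' _ => Finset.sum_nonneg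
      fun w _ => mul_nonneg (blockNorm_nonneg _ _ _) (blockNorm_nonneg _ _ _)) ht0 ht1).trans ?_
    refine mul_le_mul_of_nonneg_left (Finset.sum_le_sum fun w' _ => ?_) (Real.rpow_nonneg hcT.le _)
    refine (rpow_sum_le_sum_rpow _ _
      (fun w _ => mul_nonneg (blockNorm_nonneg _ _ _) (blockNorm_nonneg _ _ _)) ht0 ht1).trans (le_of_eq ?_)
    exact Finset.sum_congr rfl fun w _ => Real.mul_rpow (blockNorm_nonneg _ _ _) (blockNorm_nonneg _ _ _)
  -- integrate
  have hint : ∀ w' ∈ boxOut S x (3 * ℓ + 2), ∀ w ∈ boxIn S x (3 * ℓ + 2),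
      Integrable (fun U : GaugeConfig 4 (2 * S + 1) (Matrix.specialUnitaryGroup (Fin 3) ℂ) =>
        ‖(diracMatrix U mq).det‖ *
          (blockNorm (gside (ebox S x (3 * ℓ + 2))ᶜ (wilsonD U (mq f))) v' w' ^ t *
            blockNorm (wilsonD U (mq f))⁻¹ w y ^ t))
        (wilsonMeasure (fundamentalRep (Fin 3)) β) :=
    fun w' _ w _ => c1_integrable_two hT0 ht0.le hts hadm v' w' w y
  have hintu := c1_integrable_inv hT0 ht0.le hts v' y
  calc pqE Nf S β mq (fun U => blockNorm (gside (ebox S x (3 * ℓ + 2))ᶜ (wilsonD U (mq f))) v' y ^ t)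
      ≤ pqE Nf S β mq (fun U => blockNorm (wilsonD U (mq f))⁻¹ v' y ^ t +
          cT ^ t * ∑ w' ∈ boxOut S x (3 * ℓ + 2), ∑ w ∈ boxIn S x (3 * ℓ + 2),
            blockNorm (gside (ebox S x (3 * ℓ + 2))ᶜ (wilsonD U (mq f))) v' w' ^ t *
              blockNorm (wilsonD U (mq f))⁻¹ w y ^ t) := by
        refine c1_pqE_mono_ae β mq _ _ (fun U => Real.rpow_nonneg (blockNorm_nonneg _ _ _) _) ?_ hae
        refine (hintu.add (c1_integrable_weight_const_sum₂ β mq _ _ (cT ^ t) _ hint)).congr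
          (Eventually.of_forall fun U => ?_)
        simp only [Pi.add_apply, mul_add]
    _ = pqE Nf S β mq (fun U => blockNorm (wilsonD U (mq f))⁻¹ v' y ^ t) +
          cT ^ t * ∑ w' ∈ boxOut S x (3 * ℓ + 2), ∑ w ∈ boxIn S x (3 * ℓ + 2), pqE Nf S β mq (fun U =>
            blockNorm (gside (ebox S x (3 * ℓ + 2))ᶜ (wilsonD U (mq f))) v' w' ^ t *
              blockNorm (wilsonD U (mq f))⁻¹ w y ^ t) := by
        rw [c1_pqE_add β mq _ _ hintu (c1_integrable_weight_const_sum₂ β mq _ _ (cT ^ t) _ hint),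
          c1_pqE_const_sum₂ β mq _ _ _ _ hint]
    _ ≤ pqE Nf S β mq (fun U => blockNorm (wilsonD U (mq f))⁻¹ v' y ^ t) +
          cT ^ t * ∑ w' ∈ boxOut S x (3 * ℓ + 2), ∑ w ∈ boxIn S x (3 * ℓ + 2),
            C * (1 + |β|) ^ p * (1 + ((3 * ℓ + 2 : ℕ) : ℝ)) ^ p *
              pqE Nf S β mq (fun U => blockNorm (wilsonD U (mq f))⁻¹ w y ^ t) := by
        refine add_le_add le_rfl (mul_le_mul_of_nonneg_left
          (Finset.sum_le_sum fun w' hw' => Finset.sum_le_sum fun w _ => ?_) (Real.rpow_nonneg hcT.le _))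
        exact hTdec x (3 * ℓ + 2) hr1 hrS _ (Or.inr (Or.inl rfl)) v' w' w y (Finset.mem_compl.2 hv')
          (Finset.mem_compl.2 (c1_not_mem_ebox_of_mem_boxOut hrS2 hw'))
    _ = _ := by
        congr 1
        simp only [Finset.sum_const, nsmul_eq_mul, Finset.mul_sum]
        refine Finset.sum_congr rfl fun w _ => ?_
        ring

omit hcT hTdec
include hC hCf hT1 hFar

/-- **The two-cut bound** ((R2) a.e. + subadditivity + (T1) + `FarStability`): if the exit moment of
`W = ebox(x, ℓ)` obeys `A(u)^θ + A(u) ≤ α` on `boxIn ℓ`, then for `y ∉ Λ = ebox(x, 3ℓ+2)`,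
`E(x,y) ≤ (c_T²)^t |boxIn ℓ| |boxOut ℓ| |boxIn(3ℓ+2)| Ξ_ℓ R_ℓ α Σ_{v' ∈ boxOut(3ℓ+2)} pqE[‖G_{Λᶜ}(v',y)‖^t]`.
[cite: AizenmanEtAl2001, §2 (2.15)–(2.17)] -/
theorem c1_twoCut_le (x : TorusSite 4 (2 * S + 1)) {ℓ : ℕ} (hℓ1 : 1 ≤ ℓ) (hℓS : 3 * ℓ + 4 ≤ S) {α : ℝ}
    (hA : ∀ u ∈ boxIn S x ℓ,
      pqE Nf S β mq (fun U => blockNorm (gside (ebox S x ℓ) (wilsonD U (mq f))) x u ^ t) ^ θ +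
        pqE Nf S β mq (fun U => blockNorm (gside (ebox S x ℓ) (wilsonD U (mq f))) x u ^ t) ≤ α)
    (y : TorusSite 4 (2 * S + 1)) (hy : y ∉ ebox S x (3 * ℓ + 2)) :
    pqE Nf S β mq (fun U => blockNorm (wilsonD U (mq f))⁻¹ x y ^ t) ≤
      (cT ^ 2) ^ t * (boxIn S x ℓ).card * (boxOut S x ℓ).card * (boxIn S x (3 * ℓ + 2)).card *
        (C * (1 + |β|) ^ p * (1 + (ℓ : ℝ)) ^ p) * (Cf * (1 + |β|) ^ pf * (1 + (ℓ : ℝ)) ^ pf) * α *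
        ∑ v' ∈ boxOut S x (3 * ℓ + 2),
          pqE Nf S β mq (fun U => blockNorm (gside (ebox S x (3 * ℓ + 2))ᶜ (wilsonD U (mq f))) v' y ^ t) := by
  have hℓ2 : ℓ + 2 ≤ S := by omega
  have hℓ1S : ℓ + 1 ≤ S := by omega
  have hr1 : 1 ≤ 3 * ℓ + 2 := by omega
  have hrS : 3 * ℓ + 2 + 1 ≤ S := by omega
  have hrS2 : 3 * ℓ + 2 + 2 ≤ S := by omega
  have h33 : 3 * ℓ + 3 ≤ S := by omega
  have hadmW : AdmissibleSide S (ebox S x ℓ) := Or.inr ⟨x, ℓ, hℓ1, hℓ1S, Or.inl rfl⟩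
  have hadmΛ : AdmissibleSide S (ebox S x (3 * ℓ + 2))ᶜ := Or.inr ⟨x, 3 * ℓ + 2, hr1, hrS, Or.inr (Or.inl rfl)⟩
  have hc2 : 0 ≤ cT ^ 2 := sq_nonneg _
  -- the a.e. pointwise bound
  have hae : ∀ᵐ U ∂(wilsonMeasure (d := 4) (L := 2 * S + 1) (fundamentalRep (Fin 3)) β),
      blockNorm (wilsonD U (mq f))⁻¹ x y ^ t ≤
        (cT ^ 2) ^ t * ∑ u ∈ boxIn S x ℓ, ∑ u' ∈ boxOut S x ℓ,
          ∑ v ∈ boxIn S x (3 * ℓ + 2), ∑ v' ∈ boxOut S x (3 * ℓ + 2),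
            blockNorm (gside (ebox S x ℓ) (wilsonD U (mq f))) x u ^ t *
              blockNorm (wilsonD U (mq f))⁻¹ u' v ^ t *
              blockNorm (gside (ebox S x (3 * ℓ + 2))ᶜ (wilsonD U (mq f))) v' y ^ t := by
    filter_upwards [hTinv _ hadmW, hTinv _ hadmΛ] with U hW hΛ
    have h1 := (((hR U x).2 ℓ hℓ1 hℓ2).2 hℓS).2 y hy hW hΛ
    have hnn : ∀ u u' v v' : TorusSite 4 (2 * S + 1),
        0 ≤ blockNorm (gside (ebox S x ℓ) (wilsonD U (mq f))) x u * blockNorm (wilsonD U (mq f))⁻¹ u' v *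
          blockNorm (gside (ebox S x (3 * ℓ + 2))ᶜ (wilsonD U (mq f))) v' y := fun _ _ _ _ =>
      mul_nonneg (mul_nonneg (blockNorm_nonneg _ _ _) (blockNorm_nonneg _ _ _)) (blockNorm_nonneg _ _ _)
    refine (Real.rpow_le_rpow (blockNorm_nonneg _ _ _) h1 ht0.le).trans ?_
    rw [Real.mul_rpow hc2 (Finset.sum_nonneg fun _ _ => Finset.sum_nonneg fun _ _ =>
      Finset.sum_nonneg fun _ _ => Finset.sum_nonneg fun _ _ => hnn _ _ _ _)]
    refine mul_le_mul_of_nonneg_left ((c1_rpow_sum4_le _ _ _ _ _ (fun u u' v v' => hnn u u' v v') ht0 ht1).trans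
      (le_of_eq ?_)) (Real.rpow_nonneg hc2 _)
    refine Finset.sum_congr rfl fun u _ => Finset.sum_congr rfl fun u' _ =>
      Finset.sum_congr rfl fun v _ => Finset.sum_congr rfl fun v' _ => ?_
    rw [Real.mul_rpow (mul_nonneg (blockNorm_nonneg _ _ _) (blockNorm_nonneg _ _ _)) (blockNorm_nonneg _ _ _),
      Real.mul_rpow (blockNorm_nonneg _ _ _) (blockNorm_nonneg _ _ _)]
  -- integrate
  have hint : ∀ u ∈ boxIn S x ℓ, ∀ u' ∈ boxOut S x ℓ, ∀ v ∈ boxIn S x (3 * ℓ + 2), ∀ v' ∈ boxOut S x (3 * ℓ + 2),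
      Integrable (fun U : GaugeConfig 4 (2 * S + 1) (Matrix.specialUnitaryGroup (Fin 3) ℂ) =>
        ‖(diracMatrix U mq).det‖ *
          (blockNorm (gside (ebox S x ℓ) (wilsonD U (mq f))) x u ^ t *
            blockNorm (wilsonD U (mq f))⁻¹ u' v ^ t *
            blockNorm (gside (ebox S x (3 * ℓ + 2))ᶜ (wilsonD U (mq f))) v' y ^ t))
        (wilsonMeasure (fundamentalRep (Fin 3)) β) :=
    fun u _ u' _ v _ v' _ => c1_integrable_three hT0 ht0.le hts hadmW hadmΛ x u u' v v' y
  -- the constant after (T1) and far stability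
  set K : ℝ := (C * (1 + |β|) ^ p * (1 + (ℓ : ℝ)) ^ p) * (Cf * (1 + |β|) ^ pf * (1 + (ℓ : ℝ)) ^ pf) * α with hK
  have hΞ : 0 ≤ C * (1 + |β|) ^ p * (1 + (ℓ : ℝ)) ^ p :=
    mul_nonneg (mul_nonneg hC.le (Real.rpow_nonneg (by positivity) _)) (Real.rpow_nonneg (by positivity) _)
  have hP0 : ∀ v' : TorusSite 4 (2 * S + 1),
      0 ≤ pqE Nf S β mq (fun U => blockNorm (gside (ebox S x (3 * ℓ + 2))ᶜ (wilsonD U (mq f))) v' y ^ t) :=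
    fun v' => pqE_nonneg β mq _ fun U => Real.rpow_nonneg (blockNorm_nonneg _ _ _) _
  have hterm : ∀ u ∈ boxIn S x ℓ, ∀ u' ∈ boxOut S x ℓ, ∀ v ∈ boxIn S x (3 * ℓ + 2),
      ∀ v' ∈ boxOut S x (3 * ℓ + 2),
      pqE Nf S β mq (fun U =>
          blockNorm (gside (ebox S x ℓ) (wilsonD U (mq f))) x u ^ t * blockNorm (wilsonD U (mq f))⁻¹ u' v ^ t *
            blockNorm (gside (ebox S x (3 * ℓ + 2))ᶜ (wilsonD U (mq f))) v' y ^ t) ≤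
        K * pqE Nf S β mq (fun U => blockNorm (gside (ebox S x (3 * ℓ + 2))ᶜ (wilsonD U (mq f))) v' y ^ t) := by
    intro u hu u' hu' v hv v' hv'
    have hv'Λ : v' ∉ ebox S x (3 * ℓ + 2) := c1_not_mem_ebox_of_mem_boxOut hrS2 hv'
    have h1 := hT1 x ℓ hℓ1 hℓS u u' v v' y (c1_mem_ebox_three_of_mem_boxOut hu')
      (c1_not_mem_ebox_of_mem_boxOut hℓ2 hu') (c1_boxIn_subset_ebox x _ hv)
      (c1_not_mem_ebox_of_mem_boxIn_three hℓ1 h33 hv) hv'Λ hy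
    have h2 := hFar x ℓ hℓ1 hℓS u v' y (c1_boxIn_subset_ebox x ℓ hu) hv'Λ hy
    have h3 := hA u hu
    calc _ ≤ _ := h1
      _ ≤ (C * (1 + |β|) ^ p * (1 + (ℓ : ℝ)) ^ p) * ((Cf * (1 + |β|) ^ pf * (1 + (ℓ : ℝ)) ^ pf) * α *
            pqE Nf S β mq (fun U => blockNorm (gside (ebox S x (3 * ℓ + 2))ᶜ (wilsonD U (mq f))) v' y ^ t)) := by
          refine mul_le_mul_of_nonneg_left (h2.trans ?_) hΞ
          refine mul_le_mul_of_nonneg_right (mul_le_mul_of_nonneg_left h3 ?_) (hP0 v')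
          exact mul_nonneg (mul_nonneg hCf.le (Real.rpow_nonneg (by positivity) _)) (Real.rpow_nonneg (by positivity) _)
      _ = _ := by rw [hK]; ring
  calc pqE Nf S β mq (fun U => blockNorm (wilsonD U (mq f))⁻¹ x y ^ t)
      ≤ pqE Nf S β mq (fun U => (cT ^ 2) ^ t * ∑ u ∈ boxIn S x ℓ, ∑ u' ∈ boxOut S x ℓ,
          ∑ v ∈ boxIn S x (3 * ℓ + 2), ∑ v' ∈ boxOut S x (3 * ℓ + 2),
            blockNorm (gside (ebox S x ℓ) (wilsonD U (mq f))) x u ^ t *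
              blockNorm (wilsonD U (mq f))⁻¹ u' v ^ t *
              blockNorm (gside (ebox S x (3 * ℓ + 2))ᶜ (wilsonD U (mq f))) v' y ^ t) :=
        c1_pqE_mono_ae β mq _ _ (fun U => Real.rpow_nonneg (blockNorm_nonneg _ _ _) _)
          (c1_integrable_weight_const_sum₄ β mq _ _ _ _ _ _ hint) hae
    _ = (cT ^ 2) ^ t * ∑ u ∈ boxIn S x ℓ, ∑ u' ∈ boxOut S x ℓ,
          ∑ v ∈ boxIn S x (3 * ℓ + 2), ∑ v' ∈ boxOut S x (3 * ℓ + 2), pqE Nf S β mq (fun U =>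
            blockNorm (gside (ebox S x ℓ) (wilsonD U (mq f))) x u ^ t *
              blockNorm (wilsonD U (mq f))⁻¹ u' v ^ t *
              blockNorm (gside (ebox S x (3 * ℓ + 2))ᶜ (wilsonD U (mq f))) v' y ^ t) :=
        c1_pqE_const_sum₄ β mq _ _ _ _ _ _ hint
    _ ≤ (cT ^ 2) ^ t * ∑ u ∈ boxIn S x ℓ, ∑ u' ∈ boxOut S x ℓ,
          ∑ v ∈ boxIn S x (3 * ℓ + 2), ∑ v' ∈ boxOut S x (3 * ℓ + 2),
            K * pqE Nf S β mq (fun U => blockNorm (gside (ebox S x (3 * ℓ + 2))ᶜ (wilsonD U (mq f))) v' y ^ t) :=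
        mul_le_mul_of_nonneg_left (Finset.sum_le_sum fun u hu => Finset.sum_le_sum fun u' hu' =>
          Finset.sum_le_sum fun v hv => Finset.sum_le_sum fun v' hv' => hterm u hu u' hu' v hv v' hv')
          (Real.rpow_nonneg hc2 _)
    _ = _ := by
        rw [hK]
        simp only [Finset.sum_const, nsmul_eq_mul, Finset.mul_sum]
        refine Finset.sum_congr rfl fun v' _ => ?_
        ring

include hcT hTdec

/-- **One-step subharmonicity across the thick collar** (`c1_twoCut_le` + `c1_far_le`): under the same
hypotheses, for `y ∉ Λ`,
`E(x,y) ≤ Γ Σ_{z ∈ boxIn(3ℓ+2) ∪ boxOut(3ℓ+2)} E(z,y)` with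
`Γ = K₁ (1 + c_T^t Ξ_{3ℓ+2} |boxOut(3ℓ+2)|²)`, `K₁ = (c_T²)^t |boxIn ℓ||boxOut ℓ||boxIn(3ℓ+2)| Ξ_ℓ R_ℓ α`.
[cite: AizenmanEtAl2001, §2 (2.17), Lemma 6] -/
theorem c1_subharmonic_le (x : TorusSite 4 (2 * S + 1)) {ℓ : ℕ} (hℓ1 : 1 ≤ ℓ) (hℓS : 3 * ℓ + 4 ≤ S)
    {α : ℝ} (hα : 0 ≤ α)
    (hA : ∀ u ∈ boxIn S x ℓ,
      pqE Nf S β mq (fun U => blockNorm (gside (ebox S x ℓ) (wilsonD U (mq f))) x u ^ t) ^ θ +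
        pqE Nf S β mq (fun U => blockNorm (gside (ebox S x ℓ) (wilsonD U (mq f))) x u ^ t) ≤ α)
    (y : TorusSite 4 (2 * S + 1)) (hy : y ∉ ebox S x (3 * ℓ + 2)) :
    pqE Nf S β mq (fun U => blockNorm (wilsonD U (mq f))⁻¹ x y ^ t) ≤
      ((cT ^ 2) ^ t * (boxIn S x ℓ).card * (boxOut S x ℓ).card * (boxIn S x (3 * ℓ + 2)).card *
        (C * (1 + |β|) ^ p * (1 + (ℓ : ℝ)) ^ p) * (Cf * (1 + |β|) ^ pf * (1 + (ℓ : ℝ)) ^ pf) * α *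
        (1 + cT ^ t * (C * (1 + |β|) ^ p * (1 + ((3 * ℓ + 2 : ℕ) : ℝ)) ^ p) * (boxOut S x (3 * ℓ + 2)).card *
          (boxOut S x (3 * ℓ + 2)).card)) *
        ∑ z ∈ boxIn S x (3 * ℓ + 2) ∪ boxOut S x (3 * ℓ + 2),
          pqE Nf S β mq (fun U => blockNorm (wilsonD U (mq f))⁻¹ z y ^ t) := by
  have hrS2 : 3 * ℓ + 2 + 2 ≤ S := by omega
  -- abbreviations
  set K₁ : ℝ := (cT ^ 2) ^ t * (boxIn S x ℓ).card * (boxOut S x ℓ).card * (boxIn S x (3 * ℓ + 2)).card *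
    (C * (1 + |β|) ^ p * (1 + (ℓ : ℝ)) ^ p) * (Cf * (1 + |β|) ^ pf * (1 + (ℓ : ℝ)) ^ pf) * α with hK₁
  set M₂ : ℝ := cT ^ t * (C * (1 + |β|) ^ p * (1 + ((3 * ℓ + 2 : ℕ) : ℝ)) ^ p) *
    (boxOut S x (3 * ℓ + 2)).card with hM₂
  set EI : ℝ := ∑ w ∈ boxIn S x (3 * ℓ + 2), pqE Nf S β mq (fun U => blockNorm (wilsonD U (mq f))⁻¹ w y ^ t)
    with hEI
  set EO : ℝ := ∑ v' ∈ boxOut S x (3 * ℓ + 2), pqE Nf S β mq (fun U => blockNorm (wilsonD U (mq f))⁻¹ v' y ^ t)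
    with hEO
  have hE0 : ∀ z : TorusSite 4 (2 * S + 1), 0 ≤ pqE Nf S β mq (fun U => blockNorm (wilsonD U (mq f))⁻¹ z y ^ t) :=
    fun z => pqE_nonneg β mq _ fun U => Real.rpow_nonneg (blockNorm_nonneg _ _ _) _
  have hEI0 : 0 ≤ EI := Finset.sum_nonneg fun z _ => hE0 z
  have hEO0 : 0 ≤ EO := Finset.sum_nonneg fun z _ => hE0 z
  have hβ0 : 0 < 1 + |β| := by positivity
  have hΞ : 0 ≤ C * (1 + |β|) ^ p * (1 + (ℓ : ℝ)) ^ p :=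
    mul_nonneg (mul_nonneg hC.le (Real.rpow_nonneg hβ0.le _)) (Real.rpow_nonneg (by positivity) _)
  have hΞ' : 0 ≤ C * (1 + |β|) ^ p * (1 + ((3 * ℓ + 2 : ℕ) : ℝ)) ^ p :=
    mul_nonneg (mul_nonneg hC.le (Real.rpow_nonneg hβ0.le _)) (Real.rpow_nonneg (by positivity) _)
  have hRℓ : 0 ≤ Cf * (1 + |β|) ^ pf * (1 + (ℓ : ℝ)) ^ pf :=
    mul_nonneg (mul_nonneg hCf.le (Real.rpow_nonneg hβ0.le _)) (Real.rpow_nonneg (by positivity) _)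
  have hK₁0 : 0 ≤ K₁ := by
    rw [hK₁]
    refine mul_nonneg (mul_nonneg (mul_nonneg ?_ hΞ) hRℓ) hα
    exact mul_nonneg (mul_nonneg (mul_nonneg (Real.rpow_nonneg (sq_nonneg _) _) (Nat.cast_nonneg _))
      (Nat.cast_nonneg _)) (Nat.cast_nonneg _)
  have hM₂0 : 0 ≤ M₂ := by
    rw [hM₂]; exact mul_nonneg (mul_nonneg (Real.rpow_nonneg hcT.le _) hΞ') (Nat.cast_nonneg _)
  -- the two-cut bound and the far bound
  have h1 := c1_twoCut_le ht0 ht1 hts hC hCf hT0 hTinv hT1 hFar hR x hℓ1 hℓS hA y hy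
  have h2 : ∑ v' ∈ boxOut S x (3 * ℓ + 2),
      pqE Nf S β mq (fun U => blockNorm (gside (ebox S x (3 * ℓ + 2))ᶜ (wilsonD U (mq f))) v' y ^ t) ≤
      EO + (boxOut S x (3 * ℓ + 2)).card * (M₂ * EI) := by
    calc ∑ v' ∈ boxOut S x (3 * ℓ + 2),
          pqE Nf S β mq (fun U => blockNorm (gside (ebox S x (3 * ℓ + 2))ᶜ (wilsonD U (mq f))) v' y ^ t)
        ≤ ∑ v' ∈ boxOut S x (3 * ℓ + 2),
            (pqE Nf S β mq (fun U => blockNorm (wilsonD U (mq f))⁻¹ v' y ^ t) + M₂ * EI) :=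
          Finset.sum_le_sum fun v' hv' =>
            c1_far_le ht0 ht1 hts hcT hT0 hTinv hTdec hR x hℓ1 hℓS v' y (c1_not_mem_ebox_of_mem_boxOut hrS2 hv') hy
      _ = EO + (boxOut S x (3 * ℓ + 2)).card * (M₂ * EI) := by
          rw [Finset.sum_add_distrib, Finset.sum_const, nsmul_eq_mul]
  have hunion : ∑ z ∈ boxIn S x (3 * ℓ + 2) ∪ boxOut S x (3 * ℓ + 2),
      pqE Nf S β mq (fun U => blockNorm (wilsonD U (mq f))⁻¹ z y ^ t) = EI + EO :=
    Finset.sum_union (c1_disjoint_boxIn_boxOut x hrS2)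
  rw [hunion]
  have hc0 : (0 : ℝ) ≤ (boxOut S x (3 * ℓ + 2)).card := Nat.cast_nonneg _
  have h3 : EO + (boxOut S x (3 * ℓ + 2)).card * (M₂ * EI) ≤
      (1 + M₂ * (boxOut S x (3 * ℓ + 2)).card) * (EI + EO) := by
    have h4 : (1 + M₂ * (boxOut S x (3 * ℓ + 2)).card) * (EI + EO) - (EO + (boxOut S x (3 * ℓ + 2)).card * (M₂ * EI)) =
        EI + M₂ * (boxOut S x (3 * ℓ + 2)).card * EO := by ring
    have h5 : 0 ≤ M₂ * (boxOut S x (3 * ℓ + 2)).card * EO := mul_nonneg (mul_nonneg hM₂0 hc0) hEO0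
    linarith
  calc pqE Nf S β mq (fun U => blockNorm (wilsonD U (mq f))⁻¹ x y ^ t)
      ≤ K₁ * ∑ v' ∈ boxOut S x (3 * ℓ + 2),
          pqE Nf S β mq (fun U => blockNorm (gside (ebox S x (3 * ℓ + 2))ᶜ (wilsonD U (mq f))) v' y ^ t) := h1
    _ ≤ K₁ * (EO + (boxOut S x (3 * ℓ + 2)).card * (M₂ * EI)) := mul_le_mul_of_nonneg_left h2 hK₁0
    _ ≤ K₁ * ((1 + M₂ * (boxOut S x (3 * ℓ + 2)).card) * (EI + EO)) := mul_le_mul_of_nonneg_left h3 hK₁0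
    _ = K₁ * (1 + M₂ * (boxOut S x (3 * ℓ + 2)).card) * (EI + EO) := by ring

end Steps

end Summit.QuantumFields.QCD.Theorems.VonMisesCirclesC1
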